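import Literature.Analysis.FluidPDE.PassiveVectorTensorModalAdjointCoeff
import HarnessLib

/-!
# K1L_D (stmt-AnomalousDissipation-27980), registry v8 — W7 ENGINE, THREE-MODE CHAIN: the DEFINITIONS (chain right-hand sides and cross term; abstract and on the fibre `ℂ³`)

Theorems-side landing (definitions only, reviewed) of the definitional part of planner ad-ideate-p4 g13's kernel-checked crux workfile
`Cruxes/LagrangianRenormalisationStep/Lines/onelevel_W7_threemode_vector.lean` v3 (crux write commit 5e650f09fd83, 0 sorry): texts VERBATIM, namespace
moved from `…Cruxes.LagrangianRenormalisationStep.ThreeMode` to `…Theorems.SolenoidalFractalHomogenisation.LagrangianStep.ThreeMode`, the abbreviation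
`C3` spelled out as `EuclideanSpace ℂ (Fin 3)` (no `abbrev`).  The theorems (form inequality, equivalence, ramp pairing; fibre instantiation, coercivity
and upper norm bound of the modal generator) land in the companion proof files `…W7ThreeModeForm.lean` / `…W7ThreeModeFibre.lean`.
Setting (one slot, one Bloch fibre, chain modes `0, ±1, ±2`, coupling `l` frozen, phases gauged): `ẇ₀ = −y₀ + l•P₀(w₊ − w₋)`,
`ẇ₊ = −y₊ − l•(P₊w₀ − P₊w₊₊)`, `ẇ₋ = −y₋ − l•(P₋w₋₋ − P₋w₀)`, cross vector `b = l•P₀(w₊ − w₋)`, `xdot = ⟪ẇ₀, b⟫ + ⟪w₀, l•P₀(ẇ₊ − ẇ₋)⟫`.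
Landed by the W7 assembly owner (prover ad-sawtooth-k1loc-p1 g11, tenure GO 21:32:19Z); mathematics: p4 g13 (lens «control»), memo `Lines/onelevel-W7-threemode.md`.
NOT a proof of anything; rung F-D1.A0. [cite: BedrossianCotiZelati2017, §2 (hypocoercivity functional with a cross term)] [problem: turb]
-/

set_option linter.dupNamespace false

namespace Summit.AnomalousDissipation.AnomalousDissipation.Theorems.SolenoidalFractalHomogenisation.LagrangianStep.ThreeMode

open scoped InnerProductSpace

section Vector

variable {E : Type*} [NormedAddCommGroup E] [InnerProductSpace ℝ E]


/-- The chain right-hand sides of modes `0, +1, −1` (coupling `l` frozen, phases gauged):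
`ẇ₀ = −y₀ + l•P₀(w₊ − w₋)`, `ẇ₊ = −y₊ − l•(P₊w₀ − P₊w₊₊)`, `ẇ₋ = −y₋ − l•(P₋w₋₋ − P₋w₀)`. -/
def dW0 (l : ℝ) (P0 : E → E) (wp wm y0 : E) : E := -y0 + l • P0 (wp - wm)
/-- see `dW0` -/
def dWp (l : ℝ) (Pp : E → E) (w0 wpp yp : E) : E := -yp - l • (Pp w0 - Pp wpp)
/-- see `dW0` -/
def dWm (l : ℝ) (Pm : E → E) (w0 wmm ym : E) : E := -ym - l • (Pm wmm - Pm w0)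
/-- The cross vector `b = l • P₀(w₊ − w₋)` (`= ẇ₀ + y₀`). -/
def bV (l : ℝ) (P0 : E → E) (wp wm : E) : E := l • P0 (wp - wm)

/-- `xdotV = ⟪ẇ₀, b⟫ + ⟪w₀, l • P₀(ẇ₊ − ẇ₋)⟫` — the time derivative of the cross term `X = ⟪w₀, b⟫` along the chain with `l`
frozen (for a linear continuous `P₀`, `ḃ = l • P₀(ẇ₊ − ẇ₋)`; the `l̇` part is `ramp_term_le` of the scalar file). -/
def xdotV (l : ℝ) (P0 Pp Pm : E → E) (w0 wp wm wpp wmm y0 yp ym : E) : ℝ :=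
  ⟪dW0 l P0 wp wm y0, bV l P0 wp wm⟫_ℝ + ⟪w0, l • P0 (dWp l Pp w0 wpp yp - dWm l Pm w0 wmm ym)⟫_ℝ

end Vector

section Fibre

open Literature.Analysis.FluidPDE Literature.Analysis.FluidPDE.Torus

/-- `ẇ₀ = −y₀ + l•P₀(w₊ − w₋)` on the fibre. -/
noncomputable def dW0C (l : ℝ) (K0 : Fin 3 → ℤ) (wp wm y0 : (EuclideanSpace ℂ (Fin 3))) : (EuclideanSpace ℂ (Fin 3)) := -y0 + (l : ℂ) • transversalProj K0 (wp - wm)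
/-- `ẇ₊ = −y₊ − l•(P₊w₀ − P₊w₊₊)`. -/
noncomputable def dWpC (l : ℝ) (Kp : Fin 3 → ℤ) (w0 wpp yp : (EuclideanSpace ℂ (Fin 3))) : (EuclideanSpace ℂ (Fin 3)) :=
  -yp - (l : ℂ) • (transversalProj Kp w0 - transversalProj Kp wpp)
/-- `ẇ₋ = −y₋ − l•(P₋w₋₋ − P₋w₀)`. -/
noncomputable def dWmC (l : ℝ) (Km : Fin 3 → ℤ) (w0 wmm ym : (EuclideanSpace ℂ (Fin 3))) : (EuclideanSpace ℂ (Fin 3)) :=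
  -ym - (l : ℂ) • (transversalProj Km wmm - transversalProj Km w0)
/-- The cross vector `b = l•P₀(w₊ − w₋)`. -/
noncomputable def bC (l : ℝ) (K0 : Fin 3 → ℤ) (wp wm : (EuclideanSpace ℂ (Fin 3))) : (EuclideanSpace ℂ (Fin 3)) := (l : ℂ) • transversalProj K0 (wp - wm)
/-- `Ẋ` with `l` frozen: `Re⟪ẇ₀, b⟫ + Re⟪w₀, l•P₀(ẇ₊ − ẇ₋)⟫`. -/
noncomputable def xdotC (l : ℝ) (K0 Kp Km : Fin 3 → ℤ) (w0 wp wm wpp wmm y0 yp ym : (EuclideanSpace ℂ (Fin 3))) : ℝ :=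
  (⟪dW0C l K0 wp wm y0, bC l K0 wp wm⟫_ℂ).re
    + (⟪w0, (l : ℂ) • transversalProj K0 (dWpC l Kp w0 wpp yp - dWmC l Km w0 wmm ym)⟫_ℂ).re

end Fibre

end Summit.AnomalousDissipation.AnomalousDissipation.Theorems.SolenoidalFractalHomogenisation.LagrangianStep.ThreeMode
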